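import Summits.CriticalPhenomena.PercolationContinuityZ3.Theorems.Transplant.PlanarCells2Contain
import Summits.CriticalPhenomena.PercolationContinuityZ3.Theorems.Transplant.PlanarSkeletonPrisms
import HarnessLib

/-!
# Two-unit planar cells `PCells2` (layer L1′ of route D″ v2), part 5: every no-edge separation of the scheme in ℓ^∞-GAP-2 form
# (`PlanarSkeleton.SepInf`, lifted to any planar skeleton under `lip` alone) and in `ℤ²` form (`KozmaNitzan.Sep`), and the narrow probe
# world `probeWorldN v δ du = BtwN v δ ∪ Q x ∪ Hfull x du` with its hypothesis lists `hSQ / hSB / hSS`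

builds on p205010 (kernel theorem, internal audit signed; external expert review pending) — nothing in this file uses p205010.
Lane `prim-bschramm`, seat `prim-hp-8` (gen 28; `HOME/bschramm/DPRIME-SCOPE.md` §2 L1′ + addendum B, lead VERDICT V98, ruling (A2) of
`HOME/SHEAR-SCOPE.md` §3.9: separations in gap-2 form against the NARROW boxes); helper file (`--supports stmt-CriticalPhenomena-4575 --as helper`).
Continues `PlanarCells2Defs` / `PlanarCells2Contain`; the proofs are the one-unit proofs of `PlanarCellsSepQ` / `PlanarCellsPSep2` /
`PlanarCellsPSep3` / `PlanarCellsNarrowSep` read coordinatewise (a comparison along axis `i` uses the units `r i`, `s i` only; the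
parameter-free generalities `PCells.sepInf_of_gap`, `PCells.sepZ2_of_sepInf`, `PCells.sepInf_union_left/right`, `PCells.sep_union_right`,
`PCells.sep_of_two_ne` are imported, not restated).  Gaps: `Cell / Q` (`5r_i`), `Zone / Q` (`≥ min (5r∥, 10s∥)`), `Cell / E^far` (`5r`),
`Zone / E^far` (`≥ 10 s`), sibling `Btw / Q_{v+δ}` (`10r`), and the one tight pair — the NARROW sibling between-box `BtwN v δ'` against the
WIDE `E^far_{v,δ}` across the axis: `(5r⊥(δ') + 1) − (5r⊥(δ') − 1) = 2` where `r⊥(δ') = r (δ.1)`.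
* gap-2, wide: `Cell_sepInf_Q`, `Zone_sepInf_Q`, `Cell_sepInf_Efar`, `Zone_sepInf_Efar`, `Btw_sepInf_Q_add`; narrow: `BtwN_sepInf_Efar`,
  `Cell_sepInf_EfarN`, `Zone_sepInf_EfarN`, `BtwN_sepInf_EfarN`, `BtwN_sepInf_Q_add`;
* `ℤ²` forms: `Cell_sep_Q`, `Zone_sep_Q`, `Cell_sep_Efar`, `Zone_sep_Efar`, **`Btw_sep_Efar`** (wide sibling box, `δ' ≠ δ`: the two points
  differ in both coordinates — no gap-2 form), `Cell_sep_EfarN`, `Zone_sep_EfarN`, `BtwN_sep_EfarN`;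
* the narrow probe world: `mem_Efar_of_mem_Q_add`, `probeWorldN_subset`, `Cell_sepInf_probeWorldN`, `Zone_sepInf_probeWorldN`,
  **`Q_sepInf_probeWorldN`** (hSQ), **`BtwN_sepInf_probeWorldN`** (hSB), **`Stub_sepInf_probeWorldN`** (hSS), and their `ℤ²` forms
  (hypothesis lists VERBATIM those of `PlanarCellsPSep3` / `PlanarCellsNarrowSep`).  The WIDE probe world of `PlanarCellsPSep3` (used only
  by the `ℤ²`-edge product instance) is not re-issued: under `lip` every consumer takes the narrow world.
[cite: KozmaNitzan2024, §4 p. 26 ((29)), p. 31 ((31)) — the ℤ^d model, one unit] -/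

noncomputable section

namespace Summit.CriticalPhenomena.PercolationContinuityZ3.Theorems

namespace Transplant
open Literature.Probability.Percolation Literature.Probability.LatticeModels SimpleGraph GadgetSystem Contour
open Literature.Probability.Percolation.KozmaNitzan
open Literature.Probability.Percolation.KozmaNitzan.Cells (oth oth_ne sgOf sgOf_sign stepVec_apply_fst stepVec_apply_oth eq_oth_of_ne oth_oth
  eq_of_coords)
open PlanarSkeleton (SepInf)
open PCells (mem_psBox_iff sepInf_of_gap sepZ2_of_sepInf sepInf_union_left sepInf_union_right sep_union_right sep_of_two_ne)

namespace PCells2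

variable (P : PCells2)

/-! ## Cells and zones against cubes (gaps `5r_i`, `≥ min (5r∥, 10s∥)`) -/

/-- **Cells of other macro-vertices are ℓ^∞-gap separated from the cube `Q_v`** (`u ≠ v`; gap `5r_i` along an axis `i` where `u_i ≠ v_i`).
[cite: KozmaNitzan2024, §4 p. 26] -/
theorem Cell_sepInf_Q {u v : Site 2} (huv : u ≠ v) : SepInf (↑(P.Cell u) : Set (Site 2)) ↑(P.Q v) := by
  intro y hy z hz
  rw [Finset.mem_coe, Cell, mem_abox_iff] at hy
  rw [Finset.mem_coe, Q, mem_abox_iff] at hz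
  have hne : ∃ i : Fin 2, u i ≠ v i := by
    by_contra h
    push Not at h
    exact huv (funext h)
  obtain ⟨i, hi⟩ := hne
  have hyi := hy i; have hzi := hz i
  have hr : (1 : ℤ) ≤ P.r i := by exact_mod_cast P.one_le_r i
  push_cast at hyi hzi
  rcases P.cen_cases u v i with ⟨hk, hc⟩ | ⟨hk, hc⟩ | ⟨hk, hc⟩ | ⟨hk, hc⟩ | ⟨hk, hc⟩
  · exact sepInf_of_gap i (by omega)
  · exact sepInf_of_gap i (by omega)
  · exact absurd hk hi
  · exact sepInf_of_gap i (by omega)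
  · exact sepInf_of_gap i (by omega)

/-- **Stub zones are ℓ^∞-gap separated from every cube** `Q_v` (gap `≥ min (5r∥, 10s∥)` along the zone's axis).
[cite: KozmaNitzan2024, §4 p. 26] -/
theorem Zone_sepInf_Q (u : Site 2) (δ : MDir) (v : Site 2) : SepInf (↑(P.Zone u δ) : Set (Site 2)) ↑(P.Q v) := by
  intro y hy z hz
  rw [Finset.mem_coe, Zone, mem_psBox_iff] at hy
  rw [Finset.mem_coe, Q, mem_abox_iff] at hz
  obtain ⟨⟨hy1, hy2⟩, -, -⟩ := hy
  have hr : (1 : ℤ) ≤ P.r δ.1 := by exact_mod_cast P.one_le_r δ.1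
  have hs1 : (1 : ℤ) ≤ P.s δ.1 := by exact_mod_cast P.hs δ.1
  have hs20 : 20 * (P.s δ.1 : ℤ) ≤ P.r δ.1 := by exact_mod_cast P.twenty_mul_s_le_r δ.1
  have hza := hz δ.1
  push_cast at hza
  rcases P.cen_cases u v δ.1 with ⟨hk, hc⟩ | ⟨hk, hc⟩ | ⟨hk, hc⟩ | ⟨hk, hc⟩ | ⟨hk, hc⟩ <;>
    rcases sgOf_sign δ with hs | hs <;> rw [hs] at hy1 hy2 <;> exact sepInf_of_gap δ.1 (by omega)

/-! ## The far region against cells, zones and sibling between-boxes -/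

/-- **Cells of other macro-vertices are ℓ^∞-gap separated from `E^far_{v,δ}`** (`u ≠ v`, `u ≠ v + δ`; gaps `5r⊥` across / `5r∥` along).
[cite: KozmaNitzan2024, §4 p. 31] -/
theorem Cell_sepInf_Efar {u v : Site 2} {δ : MDir} (huv : u ≠ v) (hux : u ≠ v + stepVec δ) :
    SepInf (↑(P.Cell u) : Set (Site 2)) ↑(P.Efar v δ) := by
  intro y hy z hz
  rw [Finset.mem_coe, Cell, mem_abox_iff] at hy
  rw [Finset.mem_coe, Efar, mem_psBox_iff] at hz
  obtain ⟨⟨hz1, hz2⟩, hz3, hz4⟩ := hz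
  have hya := hy δ.1; have hyb := hy (oth δ.1)
  push_cast at hya hyb
  have hr : (1 : ℤ) ≤ P.r δ.1 := by exact_mod_cast P.one_le_r δ.1
  have hr' : (1 : ℤ) ≤ P.r (oth δ.1) := by exact_mod_cast P.one_le_r (oth δ.1)
  have hxa : (v + stepVec δ) δ.1 = v δ.1 + sgOf δ := by rw [Pi.add_apply, stepVec_apply_fst]
  have hxb : (v + stepVec δ) (oth δ.1) = v (oth δ.1) := by rw [Pi.add_apply, stepVec_apply_oth, add_zero]
  rcases P.cen_cases u v (oth δ.1) with ⟨hk, hc⟩ | ⟨hk, hc⟩ | ⟨hk, hc⟩ | ⟨hk, hc⟩ | ⟨hk, hc⟩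
  · exact sepInf_of_gap (oth δ.1) (by omega)
  · exact sepInf_of_gap (oth δ.1) (by omega)
  · -- same row: compare along the axis, `u_a ∉ {v_a, v_a + σ}`
    have hne1 : u δ.1 ≠ v δ.1 := fun h => huv (eq_of_coords δ.1 h hk)
    have hne2 : u δ.1 ≠ v δ.1 + sgOf δ := fun h => hux (eq_of_coords δ.1 (by rw [hxa, h]) (by rw [hxb, hk]))
    rcases P.cen_cases u v δ.1 with ⟨hk', hc'⟩ | ⟨hk', hc'⟩ | ⟨hk', hc'⟩ | ⟨hk', hc'⟩ | ⟨hk', hc'⟩ <;>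
      rcases sgOf_sign δ with hs | hs <;> rw [hs] at hz1 hz2 hne2 <;>
      first | exact absurd hk' hne1 | exact sepInf_of_gap δ.1 (by omega)
  · exact sepInf_of_gap (oth δ.1) (by omega)
  · exact sepInf_of_gap (oth δ.1) (by omega)

/-- **Stub zones of other macro-vertices are ℓ^∞-gap separated from `E^far_{v,δ}`** (`u ≠ v`, `u ≠ v + δ`; gap `≥ 10 s`).
[cite: KozmaNitzan2024, §4 p. 31] -/
theorem Zone_sepInf_Efar {u v : Site 2} {δ : MDir} (huv : u ≠ v) (hux : u ≠ v + stepVec δ) (δ' : MDir) :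
    SepInf (↑(P.Zone u δ') : Set (Site 2)) ↑(P.Efar v δ) := by
  intro y hy z hz
  rw [Finset.mem_coe, Zone, mem_psBox_iff] at hy
  rw [Finset.mem_coe, Efar, mem_psBox_iff] at hz
  obtain ⟨⟨hy1, hy2⟩, hy3, hy4⟩ := hy
  obtain ⟨⟨hz1, hz2⟩, hz3, hz4⟩ := hz
  have hr : (1 : ℤ) ≤ P.r δ.1 := by exact_mod_cast P.one_le_r δ.1
  have hr' : (1 : ℤ) ≤ P.r (oth δ.1) := by exact_mod_cast P.one_le_r (oth δ.1)
  have hs1 : (1 : ℤ) ≤ P.s δ.1 := by exact_mod_cast P.hs δ.1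
  have hs1' : (1 : ℤ) ≤ P.s (oth δ.1) := by exact_mod_cast P.hs (oth δ.1)
  have hs20 : 20 * (P.s δ.1 : ℤ) ≤ P.r δ.1 := by exact_mod_cast P.twenty_mul_s_le_r δ.1
  have hs20' : 20 * (P.s (oth δ.1) : ℤ) ≤ P.r (oth δ.1) := by exact_mod_cast P.twenty_mul_s_le_r (oth δ.1)
  have hxa : (v + stepVec δ) δ.1 = v δ.1 + sgOf δ := by rw [Pi.add_apply, stepVec_apply_fst]
  have hxb : (v + stepVec δ) (oth δ.1) = v (oth δ.1) := by rw [Pi.add_apply, stepVec_apply_oth, add_zero]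
  by_cases hax : δ'.1 = δ.1
  · -- zone axis = far axis
    rw [hax] at hy1 hy2 hy3 hy4
    rcases P.cen_cases u v (oth δ.1) with ⟨hk, hc⟩ | ⟨hk, hc⟩ | ⟨hk, hc⟩ | ⟨hk, hc⟩ | ⟨hk, hc⟩
    · exact sepInf_of_gap (oth δ.1) (by omega)
    · exact sepInf_of_gap (oth δ.1) (by omega)
    · have hne1 : u δ.1 ≠ v δ.1 := fun h => huv (eq_of_coords δ.1 h hk)
      have hne2 : u δ.1 ≠ v δ.1 + sgOf δ := fun h => hux (eq_of_coords δ.1 (by rw [hxa, h]) (by rw [hxb, hk]))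
      rcases P.cen_cases u v δ.1 with ⟨hk', hc'⟩ | ⟨hk', hc'⟩ | ⟨hk', hc'⟩ | ⟨hk', hc'⟩ | ⟨hk', hc'⟩ <;>
        rcases sgOf_sign δ with hs | hs <;> rw [hs] at hz1 hz2 hne2 <;>
        rcases sgOf_sign δ' with hs' | hs' <;> rw [hs'] at hy1 hy2 <;>
        first | exact absurd hk' hne1 | exact sepInf_of_gap δ.1 (by omega)
    · exact sepInf_of_gap (oth δ.1) (by omega)
    · exact sepInf_of_gap (oth δ.1) (by omega)
  · -- zone axis `δ'.1 = oth δ.1`: the zone's transverse coordinate (unit `r (oth δ'.1) = r δ.1`) is the far axis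
    have hoth : δ'.1 = oth δ.1 := eq_oth_of_ne hax
    have hoth2 : oth δ'.1 = δ.1 := by rw [hoth, oth_oth]
    rw [hoth2] at hy3 hy4
    rw [hoth] at hy1 hy2
    rcases P.cen_cases u v δ.1 with ⟨hk, hc⟩ | ⟨hk, hc⟩ | ⟨hk, hc⟩ | ⟨hk, hc⟩ | ⟨hk, hc⟩
    · exact sepInf_of_gap δ.1 (by rcases sgOf_sign δ with hs | hs <;> rw [hs] at hz1 hz2 <;> omega)
    · rcases sgOf_sign δ with hs | hs <;> rw [hs] at hz1 hz2
      · exact sepInf_of_gap δ.1 (by omega)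
      · -- `u_a = v_a - 1 = x_a` (σ = -1): compare the transverse coordinate (zone levels, unit `r (oth δ.1)`)
        rcases P.cen_cases u v (oth δ.1) with ⟨hm, hd⟩ | ⟨hm, hd⟩ | ⟨hm, hd⟩ | ⟨hm, hd⟩ | ⟨hm, hd⟩ <;>
          rcases sgOf_sign δ' with hs' | hs' <;> rw [hs'] at hy1 hy2 <;>
          exact sepInf_of_gap (oth δ.1) (by omega)
    · exact sepInf_of_gap δ.1 (by rcases sgOf_sign δ with hs | hs <;> rw [hs] at hz1 hz2 <;> omega)
    · rcases sgOf_sign δ with hs | hs <;> rw [hs] at hz1 hz2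
      · rcases P.cen_cases u v (oth δ.1) with ⟨hm, hd⟩ | ⟨hm, hd⟩ | ⟨hm, hd⟩ | ⟨hm, hd⟩ | ⟨hm, hd⟩ <;>
          rcases sgOf_sign δ' with hs' | hs' <;> rw [hs'] at hy1 hy2 <;>
          exact sepInf_of_gap (oth δ.1) (by omega)
      · exact sepInf_of_gap δ.1 (by omega)
    · exact sepInf_of_gap δ.1 (by rcases sgOf_sign δ with hs | hs <;> rw [hs] at hz1 hz2 <;> omega)

/-- **The NARROW sibling between-box `BtwN v δ'` is ℓ^∞-gap separated from `E^far_{v,δ}`** (`δ' ≠ δ`): along the axis for the reversed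
direction (gap `10r∥ + 2`), across it with gap `(5r + 1) − (5r − 1) = 2` in the unit `r (oth δ'.1) = r (δ.1)` — THE tight pair.
[cite: KozmaNitzan2024, §4 p. 31 ((31))] -/
theorem BtwN_sepInf_Efar (v : Site 2) {δ δ' : MDir} (h : δ' ≠ δ) : SepInf (↑(P.BtwN v δ') : Set (Site 2)) ↑(P.Efar v δ) := by
  intro y hy z hz
  rw [Finset.mem_coe, BtwN, mem_psBox_iff] at hy
  rw [Finset.mem_coe, Efar, mem_psBox_iff] at hz
  obtain ⟨⟨hy1, hy2⟩, hy3, hy4⟩ := hy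
  obtain ⟨⟨hz1, hz2⟩, hz3, hz4⟩ := hz
  have hr : (1 : ℤ) ≤ P.r δ.1 := by exact_mod_cast P.one_le_r δ.1
  by_cases hax : δ'.1 = δ.1
  · -- same axis, opposite signs: levels on opposite sides of `Q_v`
    have hsg : sgOf δ' = -sgOf δ := by
      have hne : δ'.2 ≠ δ.2 := fun h2 => h (Prod.ext hax h2)
      unfold sgOf; rcases Bool.eq_false_or_eq_true δ.2 with hb | hb <;> simp_all
    rw [hax, hsg] at hy1 hy2
    refine sepInf_of_gap δ.1 ?_
    rcases sgOf_sign δ with hs | hs <;> rw [hs] at hy1 hy2 hz1 hz2 <;> omega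
  · -- different axes: the transverse coordinate of `BtwN v δ'` is the axis of `Efar v δ`
    have hoth : δ.1 = oth δ'.1 := eq_oth_of_ne (Ne.symm hax)
    rw [← hoth] at hy3 hy4
    refine sepInf_of_gap δ.1 ?_
    rcases sgOf_sign δ with hs | hs <;> rw [hs] at hz1 <;> omega

/-- **A sibling between-box `Btw v δ'` is ℓ^∞-gap separated from the target cube `Q_{v+δ}`** (`δ' ≠ δ`; gaps `10r` across, `20r` along).
[cite: KozmaNitzan2024, §4 p. 26 ((29))] -/
theorem Btw_sepInf_Q_add (v : Site 2) {δ δ' : MDir} (h : δ' ≠ δ) : SepInf (↑(P.Btw v δ') : Set (Site 2)) ↑(P.Q (v + stepVec δ)) := by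
  intro y hy z hz
  rw [Finset.mem_coe, Btw, mem_psBox_iff] at hy
  rw [Finset.mem_coe, Q, mem_abox_iff] at hz
  obtain ⟨⟨hy1, hy2⟩, hy3, hy4⟩ := hy
  have hza := hz δ.1
  rw [P.cen_add_stepVec_fst] at hza
  push_cast at hza
  have hr : (1 : ℤ) ≤ P.r δ.1 := by exact_mod_cast P.one_le_r δ.1
  by_cases hax : δ'.1 = δ.1
  · have hsg : sgOf δ' = -sgOf δ := by
      have hne : δ'.2 ≠ δ.2 := fun h2 => h (Prod.ext hax h2)
      unfold sgOf; rcases Bool.eq_false_or_eq_true δ.2 with hb | hb <;> simp_all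
    rw [hax, hsg] at hy1 hy2
    refine sepInf_of_gap δ.1 ?_
    rcases sgOf_sign δ with hs | hs <;> rw [hs] at hy1 hy2 hza <;> omega
  · have hoth : δ.1 = oth δ'.1 := eq_oth_of_ne (Ne.symm hax)
    rw [← hoth] at hy3 hy4
    refine sepInf_of_gap δ.1 ?_
    rcases sgOf_sign δ with hs | hs <;> rw [hs] at hza <;> omega

/-! ### The narrow far region -/

/-- Cells of other macro-vertices are ℓ^∞-gap separated from `EfarN_{v,δ}`. [cite: KozmaNitzan2024, §4 p. 31] -/
theorem Cell_sepInf_EfarN {u v : Site 2} {δ : MDir} (huv : u ≠ v) (hux : u ≠ v + stepVec δ) :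
    SepInf (↑(P.Cell u) : Set (Site 2)) ↑(P.EfarN v δ) :=
  (P.Cell_sepInf_Efar huv hux).mono le_rfl (Finset.coe_subset.2 (P.EfarN_subset_Efar v δ))

/-- Stub zones of other macro-vertices are ℓ^∞-gap separated from `EfarN_{v,δ}`. [cite: KozmaNitzan2024, §4 p. 31] -/
theorem Zone_sepInf_EfarN {u v : Site 2} {δ : MDir} (huv : u ≠ v) (hux : u ≠ v + stepVec δ) (δ' : MDir) :
    SepInf (↑(P.Zone u δ') : Set (Site 2)) ↑(P.EfarN v δ) :=
  (P.Zone_sepInf_Efar huv hux δ').mono le_rfl (Finset.coe_subset.2 (P.EfarN_subset_Efar v δ))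

/-- **Narrow sibling between-boxes are ℓ^∞-gap separated from the narrow far region** (`δ' ≠ δ`). [cite: KozmaNitzan2024, §4 p. 31 ((31))] -/
theorem BtwN_sepInf_EfarN (v : Site 2) {δ δ' : MDir} (h : δ' ≠ δ) : SepInf (↑(P.BtwN v δ') : Set (Site 2)) ↑(P.EfarN v δ) :=
  (P.BtwN_sepInf_Efar v h).mono le_rfl (Finset.coe_subset.2 (P.EfarN_subset_Efar v δ))

/-- Narrow sibling between-boxes are ℓ^∞-gap separated from the target cube `Q_{v+δ}` (`δ' ≠ δ`). [cite: KozmaNitzan2024, §4 p. 26 ((29))] -/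
theorem BtwN_sepInf_Q_add (v : Site 2) {δ δ' : MDir} (h : δ' ≠ δ) : SepInf (↑(P.BtwN v δ') : Set (Site 2)) ↑(P.Q (v + stepVec δ)) :=
  (P.Btw_sepInf_Q_add v h).mono (Finset.coe_subset.2 (P.BtwN_subset_Btw v δ')) le_rfl

/-! ## `ℤ²` forms -/

/-- **Cells of other macro-vertices are separated from the cube `Q_v`** (`u ≠ v`): no common vertex, no `ℤ²`-edge.
[cite: KozmaNitzan2024, §4 p. 26] -/
theorem Cell_sep_Q {u v : Site 2} (huv : u ≠ v) : KozmaNitzan.Sep (↑(P.Cell u) : Set (Site 2)) ↑(P.Q v) :=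
  sepZ2_of_sepInf (P.Cell_sepInf_Q huv)

/-- **Stub zones are separated from every cube** `Q_v`. [cite: KozmaNitzan2024, §4 p. 26] -/
theorem Zone_sep_Q (u : Site 2) (δ : MDir) (v : Site 2) : KozmaNitzan.Sep (↑(P.Zone u δ) : Set (Site 2)) ↑(P.Q v) :=
  sepZ2_of_sepInf (P.Zone_sepInf_Q u δ v)

/-- **Cells of other macro-vertices are separated from `E^far_{v,δ}`** (`u ≠ v`, `u ≠ v + δ`). [cite: KozmaNitzan2024, §4 p. 31] -/
theorem Cell_sep_Efar {u v : Site 2} {δ : MDir} (huv : u ≠ v) (hux : u ≠ v + stepVec δ) :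
    KozmaNitzan.Sep (↑(P.Cell u) : Set (Site 2)) ↑(P.Efar v δ) :=
  sepZ2_of_sepInf (P.Cell_sepInf_Efar huv hux)

/-- **Stub zones of other macro-vertices are separated from `E^far_{v,δ}`** (`u ≠ v`, `u ≠ v + δ`). [cite: KozmaNitzan2024, §4 p. 31] -/
theorem Zone_sep_Efar {u v : Site 2} {δ : MDir} (huv : u ≠ v) (hux : u ≠ v + stepVec δ) (δ' : MDir) :
    KozmaNitzan.Sep (↑(P.Zone u δ') : Set (Site 2)) ↑(P.Efar v δ) :=
  sepZ2_of_sepInf (P.Zone_sepInf_Efar huv hux δ')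

/-- **Other (wide) between-boxes of `v` are separated from `E^far_{v,δ}`** (`δ' ≠ δ`): along the axis by a gap, across it the two points
differ in BOTH coordinates (the wide pair is tight: `ℤ²` form only). [cite: KozmaNitzan2024, §4 p. 31] -/
theorem Btw_sep_Efar (v : Site 2) {δ δ' : MDir} (h : δ' ≠ δ) : KozmaNitzan.Sep (↑(P.Btw v δ') : Set (Site 2)) ↑(P.Efar v δ) := by
  intro y hy z hz
  rw [Finset.mem_coe, Btw, mem_psBox_iff] at hy
  rw [Finset.mem_coe, Efar, mem_psBox_iff] at hz
  obtain ⟨⟨hy1, hy2⟩, hy3, hy4⟩ := hy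
  obtain ⟨⟨hz1, hz2⟩, hz3, hz4⟩ := hz
  by_cases hax : δ'.1 = δ.1
  · -- same axis, opposite signs: levels on opposite sides, gap along the axis
    have hsg : sgOf δ' = -sgOf δ := by
      have hne : δ'.2 ≠ δ.2 := fun h2 => h (Prod.ext hax h2)
      unfold sgOf; rcases Bool.eq_false_or_eq_true δ.2 with hb | hb <;> simp_all
    rw [hax, hsg] at hy1 hy2
    have hr : (1 : ℤ) ≤ P.r δ.1 := by exact_mod_cast P.one_le_r δ.1
    refine sep_of_gap δ.1 ?_
    rcases sgOf_sign δ with hs | hs <;> rw [hs] at hy1 hy2 hz1 hz2 <;> omega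
  · -- different axes: the points differ in both coordinates
    have hoth : δ.1 = oth δ'.1 := eq_oth_of_ne (Ne.symm hax)
    have hoth' : δ'.1 = oth δ.1 := eq_oth_of_ne hax
    rw [← hoth] at hy3 hy4
    rw [← hoth'] at hz3 hz4
    have hne_a : y δ.1 ≠ z δ.1 := by
      intro heq; rcases sgOf_sign δ with hs | hs <;> rw [hs] at hz1 <;> omega
    have hne_a' : y δ'.1 ≠ z δ'.1 := by
      intro heq; rcases sgOf_sign δ' with hs | hs <;> rw [hs] at hy1 <;> omega
    have h01 : ∀ i : Fin 2, y i ≠ z i := by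
      intro i
      rcases eq_or_ne i δ.1 with rfl | hi
      · exact hne_a
      · rw [eq_oth_of_ne hi, ← hoth']; exact hne_a'
    exact sep_of_two_ne (h01 0) (h01 1)

/-- `ℤ²` form: cells of other macro-vertices are separated from `EfarN_{v,δ}`. [cite: KozmaNitzan2024, §4 p. 31] -/
theorem Cell_sep_EfarN {u v : Site 2} {δ : MDir} (huv : u ≠ v) (hux : u ≠ v + stepVec δ) :
    KozmaNitzan.Sep (↑(P.Cell u) : Set (Site 2)) ↑(P.EfarN v δ) :=
  sepZ2_of_sepInf (P.Cell_sepInf_EfarN huv hux)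

/-- `ℤ²` form: stub zones of other macro-vertices are separated from `EfarN_{v,δ}`. [cite: KozmaNitzan2024, §4 p. 31] -/
theorem Zone_sep_EfarN {u v : Site 2} {δ : MDir} (huv : u ≠ v) (hux : u ≠ v + stepVec δ) (δ' : MDir) :
    KozmaNitzan.Sep (↑(P.Zone u δ') : Set (Site 2)) ↑(P.EfarN v δ) :=
  sepZ2_of_sepInf (P.Zone_sepInf_EfarN huv hux δ')

/-- `ℤ²` form: narrow sibling between-boxes are separated from `EfarN_{v,δ}`. [cite: KozmaNitzan2024, §4 p. 31 ((31))] -/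
theorem BtwN_sep_EfarN (v : Site 2) {δ δ' : MDir} (h : δ' ≠ δ) : KozmaNitzan.Sep (↑(P.BtwN v δ') : Set (Site 2)) ↑(P.EfarN v δ) :=
  sepZ2_of_sepInf (P.BtwN_sepInf_EfarN v h)

/-! ## The narrow probe world `BtwN v δ ∪ Q x ∪ Hfull x du` and `hSQ / hSB / hSS` -/

/-- A site of `Q (v + δ)` lies in the WIDE far region `Efar v δ` (`Q` has transverse half-width `5r⊥`, so the narrow `EfarN` would need
`M (v + δ)` instead, cf. `M_add_stepVec_subset_EfarN`). [folklore] -/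
theorem mem_Efar_of_mem_Q_add {v : Site 2} {δ : MDir} {t : Site 2} (ht : t ∈ P.Q (v + stepVec δ)) : t ∈ P.Efar v δ := by
  rw [Q, mem_abox_iff] at ht
  rw [Efar, mem_psBox_iff]
  have h1 := ht δ.1
  have h2 := ht (oth δ.1)
  rw [P.cen_add_stepVec_fst] at h1
  rw [P.cen_add_stepVec_oth] at h2
  push_cast at h1 h2 ⊢
  refine ⟨?_, h2⟩
  rcases sgOf_sign δ with hs | hs <;> rw [hs] at h1 ⊢ <;> constructor <;> nlinarith [h1.1, h1.2, P.one_le_r δ.1]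

/-- The narrow probe world lies in `EfarN v δ ∪ Q x ∪ EfarN x du` (`x = v + δ`). [folklore] -/
theorem probeWorldN_subset (v : Site 2) (δ du : MDir) :
    (↑(P.probeWorldN v δ du) : Set (Site 2)) ⊆ ↑(P.EfarN v δ) ∪ (↑(P.Q (v + stepVec δ)) ∪ ↑(P.EfarN (v + stepVec δ) du)) := by
  intro t ht
  rw [Finset.mem_coe, probeWorldN] at ht
  rcases Finset.mem_union.1 ht with ht | ht
  · rcases Finset.mem_union.1 ht with ht | ht
    · exact Or.inl (Finset.mem_coe.2 (P.BtwN_subset_EfarN v δ ht))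
    · exact Or.inr (Or.inl (Finset.mem_coe.2 ht))
  · rcases Finset.mem_union.1 (P.Hfull_subset_Q_union_EfarN _ du ht) with h' | h'
    · exact Or.inr (Or.inl (Finset.mem_coe.2 h'))
    · exact Or.inr (Or.inr (Finset.mem_coe.2 h'))

/-- **A cell off the lineage is ℓ^∞-gap separated from the narrow probe world** (`u ∉ {v, x, y}`). [cite: KozmaNitzan2024, §4 p. 31] -/
theorem Cell_sepInf_probeWorldN {v u : Site 2} {δ du : MDir} (huv : u ≠ v) (hux : u ≠ v + stepVec δ)
    (huy : u ≠ v + stepVec δ + stepVec du) : SepInf (↑(P.Cell u) : Set (Site 2)) ↑(P.probeWorldN v δ du) :=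
  (sepInf_union_right (P.Cell_sepInf_EfarN huv hux)
    (sepInf_union_right (P.Cell_sepInf_Q hux) (P.Cell_sepInf_EfarN hux huy))).mono le_rfl (P.probeWorldN_subset v δ du)

/-- **A stub zone off the lineage is ℓ^∞-gap separated from the narrow probe world** (`u ∉ {v, x, y}`). [cite: KozmaNitzan2024, §4 p. 31] -/
theorem Zone_sepInf_probeWorldN {v u : Site 2} {δ du : MDir} (huv : u ≠ v) (hux : u ≠ v + stepVec δ)
    (huy : u ≠ v + stepVec δ + stepVec du) (δ' : MDir) : SepInf (↑(P.Zone u δ') : Set (Site 2)) ↑(P.probeWorldN v δ du) :=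
  (sepInf_union_right (P.Zone_sepInf_EfarN huv hux δ')
    (sepInf_union_right (P.Zone_sepInf_Q u δ' _) (P.Zone_sepInf_EfarN hux huy δ'))).mono le_rfl (P.probeWorldN_subset v δ du)

/-- **`hSQ` (gap-2 form): cubes off the lineage are ℓ^∞-gap separated from the narrow probe world.** [cite: KozmaNitzan2024, §4 p. 26 ((29))] -/
theorem Q_sepInf_probeWorldN (v : Site 2) (δ du : MDir) (u : Site 2) (_hvy : v + stepVec δ + stepVec du ≠ v) (huv : u ≠ v)
    (hux : u ≠ v + stepVec δ) (huy : u ≠ v + stepVec δ + stepVec du) :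
    SepInf (↑(P.Q u) : Set (Site 2)) ↑(P.probeWorldN v δ du) :=
  (P.Cell_sepInf_probeWorldN huv hux huy).mono (Finset.coe_subset.2 (P.Q_subset_Cell u)) le_rfl

/-- **`hSB` (gap-2 form): narrow between-boxes off the lineage are ℓ^∞-gap separated from the narrow probe world** (`w ∉ {x, y}`,
`w + δ' ∉ {v, x, y}`; the sibling boxes of `v` itself included). [cite: KozmaNitzan2024, §4 p. 31 ((31))] -/
theorem BtwN_sepInf_probeWorldN (v : Site 2) (δ du : MDir) (w : Site 2) (δ' : MDir) (_hvy : v + stepVec δ + stepVec du ≠ v)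
    (hwx : w ≠ v + stepVec δ) (hwy : w ≠ v + stepVec δ + stepVec du) (hw'v : w + stepVec δ' ≠ v) (hw'x : w + stepVec δ' ≠ v + stepVec δ)
    (hw'y : w + stepVec δ' ≠ v + stepVec δ + stepVec du) :
    SepInf (↑(P.BtwN w δ') : Set (Site 2)) ↑(P.probeWorldN v δ du) := by
  by_cases hwv : w = v
  · subst hwv
    have hδ : δ' ≠ δ := fun h => hw'x (by rw [h])
    -- the sibling box: gap-2 against `EfarN w δ ⊇ BtwN w δ`, against `Q x` directly, and (inside `Cell w ∪ Cell (w + δ')`) against `EfarN x du`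
    refine PlanarSkeleton.SepInf.mono ?_ le_rfl (P.probeWorldN_subset w δ du)
    refine sepInf_union_right (P.BtwN_sepInf_EfarN w hδ) (sepInf_union_right (P.BtwN_sepInf_Q_add w hδ) ?_)
    refine PlanarSkeleton.SepInf.mono ?_ (Finset.coe_subset.2 (P.BtwN_subset_Cells w δ')) le_rfl
    rw [Finset.coe_union]
    refine sepInf_union_left (P.Cell_sepInf_EfarN (Ne.symm ?_) (Ne.symm ?_)) (P.Cell_sepInf_EfarN hw'x hw'y)
    · intro h; exact hwx h.symm
    · intro h; exact hwy h.symm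
  · refine PlanarSkeleton.SepInf.mono ?_ (Finset.coe_subset.2 (P.BtwN_subset_Cells w δ')) le_rfl
    rw [Finset.coe_union]
    exact sepInf_union_left (P.Cell_sepInf_probeWorldN hwv hwx hwy) (P.Cell_sepInf_probeWorldN hw'v hw'x hw'y)

/-- **`hSS` (gap-2 form): stubs off the lineage are ℓ^∞-gap separated from the narrow probe world** (`u ∉ {v, x, y}`, `j + 1 ≤ K`).
[cite: KozmaNitzan2024, §4 p. 31] -/
theorem Stub_sepInf_probeWorldN (v : Site 2) (δ du : MDir) (u : Site 2) (du' : MDir) (j : ℕ) (_hvy : v + stepVec δ + stepVec du ≠ v)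
    (huv : u ≠ v) (hux : u ≠ v + stepVec δ) (huy : u ≠ v + stepVec δ + stepVec du) (hj : j + 1 ≤ P.K) :
    SepInf (↑(P.Stub u du' j) : Set (Site 2)) ↑(P.probeWorldN v δ du) := by
  refine PlanarSkeleton.SepInf.mono ?_ (Finset.coe_subset.2 (P.Stub_subset_Cell_union_Zone u du' (by omega))) le_rfl
  rw [Finset.coe_union]
  exact sepInf_union_left (P.Cell_sepInf_probeWorldN huv hux huy) (P.Zone_sepInf_probeWorldN huv hux huy du')

/-- **`hSQ`, `ℤ²` form.** [cite: KozmaNitzan2024, §4 p. 26 ((29))] -/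
theorem Q_sep_probeWorldN (v : Site 2) (δ du : MDir) (u : Site 2) (hvy : v + stepVec δ + stepVec du ≠ v) (huv : u ≠ v)
    (hux : u ≠ v + stepVec δ) (huy : u ≠ v + stepVec δ + stepVec du) :
    KozmaNitzan.Sep (↑(P.Q u) : Set (Site 2)) ↑(P.probeWorldN v δ du) :=
  sepZ2_of_sepInf (P.Q_sepInf_probeWorldN v δ du u hvy huv hux huy)

/-- **`hSB`, `ℤ²` form.** [cite: KozmaNitzan2024, §4 p. 31 ((31))] -/
theorem BtwN_sep_probeWorldN (v : Site 2) (δ du : MDir) (w : Site 2) (δ' : MDir) (hvy : v + stepVec δ + stepVec du ≠ v)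
    (hwx : w ≠ v + stepVec δ) (hwy : w ≠ v + stepVec δ + stepVec du) (hw'v : w + stepVec δ' ≠ v) (hw'x : w + stepVec δ' ≠ v + stepVec δ)
    (hw'y : w + stepVec δ' ≠ v + stepVec δ + stepVec du) :
    KozmaNitzan.Sep (↑(P.BtwN w δ') : Set (Site 2)) ↑(P.probeWorldN v δ du) :=
  sepZ2_of_sepInf (P.BtwN_sepInf_probeWorldN v δ du w δ' hvy hwx hwy hw'v hw'x hw'y)

/-- **`hSS`, `ℤ²` form.** [cite: KozmaNitzan2024, §4 p. 31] -/
theorem Stub_sep_probeWorldN (v : Site 2) (δ du : MDir) (u : Site 2) (du' : MDir) (j : ℕ) (hvy : v + stepVec δ + stepVec du ≠ v)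
    (huv : u ≠ v) (hux : u ≠ v + stepVec δ) (huy : u ≠ v + stepVec δ + stepVec du) (hj : j + 1 ≤ P.K) :
    KozmaNitzan.Sep (↑(P.Stub u du' j) : Set (Site 2)) ↑(P.probeWorldN v δ du) :=
  sepZ2_of_sepInf (P.Stub_sepInf_probeWorldN v δ du u du' j hvy huv hux huy hj)

end PCells2

end Transplant
end Summit.CriticalPhenomena.PercolationContinuityZ3.Theorems

end
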